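import Summits.CriticalPhenomena.PercolationContinuityZ3.Theorems.PercNearOneGluingNoHeavyLowerTailSunflowerBoxLemma
import HarnessLib

/-!
# `NoHeavyLowerTail` (crux stmt-CriticalPhenomena-4575), abstract sunflower cubic: the Δ-SYSTEM-CORE THEOREM —
# Lemma A `∏ μ(V_i) ≤ μ(A)^(K−1)` for every sunflower of up-sets whose core has Δ-system minimal elements, for every product measure

Support file (seat `prim-ineq-prove-1` gen 34; `--supports stmt-CriticalPhenomena-4575`).  No `sorry`, no named facts.  Memo:
run/shared/lean/prim/prim-ineq-prove-1/FINDING-PRINCIPALCORE-prove1-g34.md §1 (T3), §3, §5.  Inputs: the general box lemma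
(`…SunflowerBoxLemma`), box events (`…SunflowerBoxEvents`), the one-block counting bound and the cell identities
(`…SunflowerTwoGeneratorCore`, `…SunflowerPrincipalCore`).

SETTING.  `μ = prodBernoulli p` on the cube `Set ι` (`ι` finite).  A Δ-SYSTEM CORE is `dcore h g = {ω | h ⊆ ω ∧ ∃ k, g k ⊆ ω}` with a kernel
`h` and pairwise disjoint petals `g k` (`k : β`) disjoint from `h`; equivalently (`prod_real_le_real_deltaCore_pow`) the up-set generated
by finitely many sets `A k` with `A k ∩ A l ⊆ h ⊆ A m` for all `k ≠ l` and all `m` — this covers principal cores (`|β| = 1`) and ALL cores with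
two minimal elements (`h = A₁ ∩ A₂`).
* `subset_Zset`, `disjoint_suppK`, `disjoint_suppG` — every event lies in the box event of its supports, and up-sets meeting inside the core
  have disjoint kernel supports and grid supports (memo §3 (a),(b)).
* `real_Zset`, `real_dcore` — laws: `μ(Zset) = (∏_{h∖Uh} p)·ζ(Ub)`, `μ(dcore) = (∏_h p)·ζ(∅)` (independence of kernel and petals).
* **`prod_real_le_real_dcore_pow`** / **`prod_real_le_real_deltaCore_pow`** — THE THEOREM: up-sets `V i` with pairwise intersections
  inside the core satisfy `∏_i μ(V i) ≤ μ(core)^(|κ|−1)` (kernel factors by `TwoGenCore.prod_prod_sdiff_le_pow`, grid factors by the box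
  lemma `BoxLemma.prod_zeta_le_pow`).
* Three petals: `lemmaA_of_deltaCore` (`μ(E₁)μ(E₂)μ(E₃) ≤ μ(A)²`), `e3_le_core_mul_AG_of_deltaCore` (`e₃ ≤ a(ab − e₂)`),
  `e3_le_max_mul_AG_of_deltaCore` ((C1-law) `e₃ ≤ max(a,b)(ab − e₂)`), `lawH_nonneg_of_deltaCore`, and Kahn's Conjecture 5 / Sahi
  `E₃ ≥ 0` for the complements, `sahiE3_compl_nonneg_of_deltaCore` — all unconditional for such cores.
LIMITS (memo §6): for cores whose minimal elements are not a Δ-system Lemma A can fail (`{12,13,23}` at `p = 0.9`: `LA/e₃ = −1`), though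
some non-Δ cores (`{12,23,14}`) are still safe; (C1-law) has no known counterexample.
-/

noncomputable section

namespace Summit.CriticalPhenomena.PercolationContinuityZ3.Theorems.SunflowerPartition

namespace DeltaCore

open MeasureTheory Finset
open Literature.Probability.LatticeModels Literature.Probability.Percolation TwoGenCore BoxLemma

variable {ι : Type*} {β : Type*}

/-! ## The core, supports, and the box event -/

/-- The Δ-system core with kernel `h` and petals `g k`: `{ω | h ⊆ ω ∧ ∃ k, g k ⊆ ω}`. [this work] -/
def dcore (h : Finset ι) (g : β → Finset ι) : Set (Set ι) := {ω | (h : Set ι) ⊆ ω ∧ ∃ k, (g k : Set ι) ⊆ ω}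

/-- Membership in the core. [this work] -/
theorem mem_dcore {h : Finset ι} {g : β → Finset ι} {ω : Set ι} :
    ω ∈ dcore h g ↔ (h : Set ι) ⊆ ω ∧ ∃ k, (g k : Set ι) ⊆ ω := Iff.rfl

open scoped Classical in
/-- Kernel support of an event: kernel coordinates missed by some non-core member. [this work] -/
def suppK (h : Finset ι) (g : β → Finset ι) (V : Set (Set ι)) : Finset ι :=
  h.filter fun e => ∃ ω ∈ V, ω ∉ dcore h g ∧ e ∉ ω

/-- **Disjoint kernel supports** for up-sets meeting inside the core (memo §3 (b)). [this work] -/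
theorem disjoint_suppK {h : Finset ι} {g : β → Finset ι} {V W : Set (Set ι)} (hV : IsUpperSet V) (hW : IsUpperSet W)
    (hVW : V ∩ W ⊆ dcore h g) : Disjoint (suppK h g V) (suppK h g W) := by
  classical
  rw [Finset.disjoint_left]
  intro e heV heW
  obtain ⟨he, ω, hω, -, heω⟩ := Finset.mem_filter.1 heV
  obtain ⟨-, ω', hω', -, heω'⟩ := Finset.mem_filter.1 heW
  have hu : ω ∪ ω' ∈ dcore h g := hVW ⟨hV Set.subset_union_left hω, hW Set.subset_union_right hω'⟩
  exact (hu.1 (Finset.mem_coe.2 he)).elim heω heω'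

variable [Fintype β] [DecidableEq β]



open scoped Classical in
/-- Grid support of an event: grid points (one coordinate per petal) entirely missed by some non-core member. [this work] -/
def suppG (h : Finset ι) (g : β → Finset ι) (V : Set (Set ι)) : Finset (β → ι) :=
  (Fintype.piFinset g).filter fun v => ∃ ω ∈ V, ω ∉ dcore h g ∧ ∀ k, v k ∉ ω

/-- The box event of a kernel target `Uh` and a grid target `Ub`: missed kernel coordinates lie in `Uh`, entirely missed grid points lie
in `Ub`. [this work] -/
def Zset (h : Finset ι) (g : β → Finset ι) (Uh : Finset ι) (Ub : Finset (β → ι)) : Set (Set ι) :=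
  {ω | ∀ e ∈ h, e ∉ ω → e ∈ Uh} ∩ Box Finset.univ g Ub

/-- **Every event lies in the box event of its supports** (memo §3 (a)). [this work] -/
theorem subset_Zset (h : Finset ι) (g : β → Finset ι) (V : Set (Set ι)) : V ⊆ Zset h g (suppK h g V) (suppG h g V) := by
  classical
  intro ω hω
  by_cases hc : ω ∈ dcore h g
  · refine ⟨fun e he heω => (heω (hc.1 (Finset.mem_coe.2 he))).elim, fun v hv hmiss => ?_⟩
    obtain ⟨k, hk⟩ := hc.2
    exact (hmiss k (Finset.mem_univ k) (hk (Finset.mem_coe.2 (Fintype.mem_piFinset.1 hv k)))).elim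
  · exact ⟨fun e he heω => Finset.mem_filter.2 ⟨he, ω, hω, hc, heω⟩,
      fun v hv hmiss => Finset.mem_filter.2 ⟨hv, ω, hω, hc, fun k => hmiss k (Finset.mem_univ k)⟩⟩

/-- **Disjoint grid supports** for up-sets meeting inside the core (memo §3 (b): boxes of different petals are disjoint). [this work] -/
theorem disjoint_suppG {h : Finset ι} {g : β → Finset ι} {V W : Set (Set ι)} (hV : IsUpperSet V) (hW : IsUpperSet W)
    (hVW : V ∩ W ⊆ dcore h g) : Disjoint (suppG h g V) (suppG h g W) := by
  classical
  rw [Finset.disjoint_left]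
  intro v hvV hvW
  obtain ⟨hv, ω, hω, -, hvω⟩ := Finset.mem_filter.1 hvV
  obtain ⟨-, ω', hω', -, hvω'⟩ := Finset.mem_filter.1 hvW
  have hu : ω ∪ ω' ∈ dcore h g := hVW ⟨hV Set.subset_union_left hω, hW Set.subset_union_right hω'⟩
  obtain ⟨k, hk⟩ := hu.2
  exact (hk (Finset.mem_coe.2 (Fintype.mem_piFinset.1 hv k))).elim (hvω k) (hvω' k)

/-- The core is the box event with empty targets. [this work] -/
theorem dcore_eq_Zset (h : Finset ι) (g : β → Finset ι) : dcore h g = Zset h g ∅ ∅ := by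
  classical
  have hB : Box (Finset.univ : Finset β) g ∅ = {ω | ∃ k, (g k : Set ι) ⊆ ω} := by
    rw [Box_emptyset_eq (fun k hk => absurd (Finset.mem_univ k) hk)]
    ext ω
    simp only [Set.mem_setOf_eq, Finset.mem_univ, true_and]
    exact exists_congr fun k => ⟨fun hk e he => hk e he, fun hk e he => hk he⟩
  ext ω
  unfold Zset
  rw [hB]
  simp only [dcore, Set.mem_setOf_eq, Set.mem_inter_iff, Finset.notMem_empty, imp_false, not_not]
  exact Iff.rfl

/-! ## Laws -/

section Law

variable [DecidableEq ι] [Fintype ι] (p : ι → unitInterval) (h : Finset ι) (g : β → Finset ι)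

/-- **Law of the box event**: kernel and grid parts are independent. [this work] -/
theorem real_Zset (hhg : ∀ k, Disjoint h (g k)) (Uh : Finset ι) (Ub : Finset (β → ι)) :
    (prodBernoulli p).real (Zset h g Uh Ub) = (∏ e ∈ h \ Uh, (p e : ℝ)) * zeta p Finset.univ g Ub := by
  classical
  have hdetK : DeterminedBy {ω : Set ι | ∀ e ∈ h, e ∉ ω → e ∈ Uh} (↑h : Set ι) :=
    determinedBy_of_mem fun ω ω' hag hω e he heω' => hω e he fun heω => heω' ((hag e he).1 heω)
  have hdetB := determinedBy_Box (Finset.univ : Finset β) g Ub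
  have hdisj : Disjoint h (Finset.univ.biUnion g) := by
    rw [Finset.disjoint_biUnion_right]; exact fun k _ => hhg k
  have hK : {ω : Set ι | ∀ e ∈ h, e ∉ ω → e ∈ Uh} = {ω | (((h \ Uh : Finset ι)) : Set ι) ⊆ ω} := by
    simpa only [Finset.inter_self] using setOf_kernel_eq h h Uh
  unfold Zset
  rw [prodBernoulli_real_inter_of_determinedBy_disjoint p hdisj hdetK hdetB MeasurableSet.of_discrete MeasurableSet.of_discrete,
    hK, prodBernoulli_real_subset]
  rfl

/-- **Law of the core**: `μ(dcore h g) = (∏_h p) · ζ(∅)`. [this work] -/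
theorem real_dcore (hhg : ∀ k, Disjoint h (g k)) :
    (prodBernoulli p).real (dcore h g) = (∏ e ∈ h, (p e : ℝ)) * zeta p Finset.univ g ∅ := by
  rw [dcore_eq_Zset h g, real_Zset p h g hhg, Finset.sdiff_empty]

end Law

/-! ## The theorem -/

/-- **Δ-SYSTEM-CORE THEOREM** (memo §1 T3, §3–§4).  For `μ = prodBernoulli p` on a finite cube, a kernel `h`, pairwise disjoint petals
`g k` disjoint from `h`, and up-sets `V i` whose pairwise intersections lie in `dcore h g = {h ⊆ ω ∧ ∃ k, g k ⊆ ω}`: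
`∏_i μ(V i) ≤ μ(dcore h g)^(|κ| − 1)`, for every `p`. [this work] -/
theorem prod_real_le_real_dcore_pow [DecidableEq ι] [Fintype ι] {κ : Type*} [Fintype κ] (p : ι → unitInterval) (h : Finset ι)
    (g : β → Finset ι)
    (hg : ∀ k l, k ≠ l → Disjoint (g k) (g l)) (hhg : ∀ k, Disjoint h (g k))
    {V : κ → Set (Set ι)} (hV : ∀ i, IsUpperSet (V i)) (hcap : ∀ i j, i ≠ j → V i ∩ V j ⊆ dcore h g) :
    ∏ i, (prodBernoulli p).real (V i) ≤ ((prodBernoulli p).real (dcore h g)) ^ (Fintype.card κ - 1) := by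
  classical
  set K := Fintype.card κ with hK
  have hq : ∀ e, 0 ≤ ((p e : unitInterval) : ℝ) ∧ ((p e : unitInterval) : ℝ) ≤ 1 := fun e => ⟨(p e).2.1, (p e).2.2⟩
  set Ph := ∏ e ∈ h, (p e : ℝ)
  have hPh : 0 ≤ Ph := Finset.prod_nonneg fun e _ => (hq e).1
  -- supports and their disjointness
  let Uh : κ → Finset ι := fun i => suppK h g (V i)
  let Ub : κ → Finset (β → ι) := fun i => suppG h g (V i)
  have hUh : ∀ i j, i ≠ j → Disjoint (Uh i) (Uh j) := fun i j hij => disjoint_suppK (hV i) (hV j) (hcap i j hij)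
  have hUb : ∀ i j, i ≠ j → ∀ v ∈ Fintype.piFinset g, v ∈ Ub i → v ∉ Ub j := fun i j hij v _ hvi hvj =>
    Finset.disjoint_left.1 (disjoint_suppG (hV i) (hV j) (hcap i j hij)) hvi hvj
  -- `μ(V i) ≤ kernel factor × grid factor`
  let KER : κ → ℝ := fun i => ∏ e ∈ h \ Uh i, (p e : ℝ)
  have hKER : ∀ i, 0 ≤ KER i := fun i => Finset.prod_nonneg fun e _ => (hq e).1
  have hVi : ∀ i, (prodBernoulli p).real (V i) ≤ KER i * zeta p Finset.univ g (Ub i) := by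
    intro i
    calc (prodBernoulli p).real (V i) ≤ (prodBernoulli p).real (Zset h g (Uh i) (Ub i)) :=
          measureReal_mono (subset_Zset h g (V i))
      _ = KER i * zeta p Finset.univ g (Ub i) := real_Zset p h g hhg (Uh i) (Ub i)
  -- kernel factors: the one-block counting bound
  have hker : ∏ i, KER i ≤ Ph ^ (K - 1) := prod_prod_sdiff_le_pow h hq Uh hUh
  -- grid factors: the box lemma
  have hbox : ∏ i, zeta p Finset.univ g (Ub i) ≤ (zeta p Finset.univ g ∅) ^ (K - 1) :=
    prod_zeta_le_pow p Finset.univ g hg (fun k hk => absurd (Finset.mem_univ k) hk) Ub hUb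
  -- assembly
  calc ∏ i, (prodBernoulli p).real (V i) ≤ ∏ i, KER i * zeta p Finset.univ g (Ub i) :=
        Finset.prod_le_prod (fun i _ => measureReal_nonneg) fun i _ => hVi i
    _ = (∏ i, KER i) * ∏ i, zeta p Finset.univ g (Ub i) := Finset.prod_mul_distrib
    _ ≤ Ph ^ (K - 1) * (zeta p Finset.univ g ∅) ^ (K - 1) :=
        mul_le_mul hker hbox (Finset.prod_nonneg fun i _ => measureReal_nonneg) (pow_nonneg hPh _)
    _ = ((prodBernoulli p).real (dcore h g)) ^ (K - 1) := by rw [real_dcore p h g hhg, mul_pow]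

omit [Fintype β] [DecidableEq β] in
/-- The up-set generated by sets `A k` with a common "kernel" `h ⊆ A k` is the Δ-system core of `h` and the petals `A k ∖ h`. [this work] -/
theorem dcore_eq [DecidableEq ι] (A : β → Finset ι) (h : Finset ι) (hsub : ∀ k, h ⊆ A k) :
    dcore h (fun k => A k \ h) = {ω | ∃ k, (A k : Set ι) ⊆ ω} := by
  ext ω
  constructor
  · rintro ⟨hh, k, hk⟩
    refine ⟨k, fun e he => ?_⟩
    by_cases heh : e ∈ h
    · exact hh (Finset.mem_coe.2 heh)
    · exact hk (Finset.mem_coe.2 (Finset.mem_sdiff.2 ⟨Finset.mem_coe.1 he, heh⟩))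
  · rintro ⟨k, hk⟩
    exact ⟨fun e he => hk (Finset.mem_coe.2 (hsub k (Finset.mem_coe.1 he))), k,
      fun e he => hk (Finset.mem_coe.2 (Finset.mem_sdiff.1 (Finset.mem_coe.1 he)).1)⟩

/-- **Δ-SYSTEM-CORE THEOREM, generator form.**  If finitely many sets `A k` satisfy `A k ∩ A l ⊆ h ⊆ A m` for all `k ≠ l` and all `m`
(their common pairwise intersection is a kernel — a Δ-system; vacuous for one generator, automatic with `h = A₁ ∩ A₂` for two), then
up-sets `V i` with pairwise intersections inside `A = {ω | ∃ k, A k ⊆ ω}` satisfy `∏_i μ(V i) ≤ μ(A)^(|κ|−1)` for every product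
measure. [this work] -/
theorem prod_real_le_real_deltaCore_pow [DecidableEq ι] [Fintype ι] {κ : Type*} [Fintype κ] (p : ι → unitInterval)
    (A : β → Finset ι) (h : Finset ι)
    (hsub : ∀ k, h ⊆ A k) (hΔ : ∀ k l, k ≠ l → A k ∩ A l ⊆ h)
    {V : κ → Set (Set ι)} (hV : ∀ i, IsUpperSet (V i)) (hcap : ∀ i j, i ≠ j → V i ∩ V j ⊆ {ω | ∃ k, (A k : Set ι) ⊆ ω}) :
    ∏ i, (prodBernoulli p).real (V i) ≤ ((prodBernoulli p).real {ω | ∃ k, (A k : Set ι) ⊆ ω}) ^ (Fintype.card κ - 1) := by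
  have hg : ∀ k l, k ≠ l → Disjoint (A k \ h) (A l \ h) := fun k l hkl =>
    Finset.disjoint_left.2 fun e hek hel =>
      (Finset.mem_sdiff.1 hek).2 (hΔ k l hkl (Finset.mem_inter.2 ⟨(Finset.mem_sdiff.1 hek).1, (Finset.mem_sdiff.1 hel).1⟩))
  have hhg : ∀ k, Disjoint h (A k \ h) := fun k => Finset.disjoint_sdiff
  rw [← dcore_eq A h hsub] at hcap ⊢
  exact prod_real_le_real_dcore_pow p h (fun k => A k \ h) hg hhg hV hcap

/-! ## Three-petal sunflowers with a Δ-system core: Lemma A and the law-level rows, unconditionally -/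

section Corollaries

variable [DecidableEq ι] [Fintype ι] (p : ι → unitInterval) (Am : β → Finset ι) (h : Finset ι)

/-- **Lemma A for Δ-system cores**: `μ(E₁) μ(E₂) μ(E₃) ≤ μ(A)²` for every three-petal sunflower of up-sets whose core is generated by a
Δ-system `Am` with kernel `h`, for every product measure. [this work] -/
theorem lemmaA_of_deltaCore (hsub : ∀ k, h ⊆ Am k) (hΔ : ∀ k l, k ≠ l → Am k ∩ Am l ⊆ h) {E₁ E₂ E₃ A : Set (Set ι)}
    (h₁ : IsUpperSet E₁) (h₂ : IsUpperSet E₂) (h₃ : IsUpperSet E₃) (h12 : E₁ ∩ E₂ = A) (h13 : E₁ ∩ E₃ = A) (h23 : E₂ ∩ E₃ = A)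
    (hA : A = {ω | ∃ k, (Am k : Set ι) ⊆ ω}) :
    (prodBernoulli p).real E₁ * (prodBernoulli p).real E₂ * (prodBernoulli p).real E₃ ≤ ((prodBernoulli p).real A) ^ 2 := by
  let V : Fin 3 → Set (Set ι) := ![E₁, E₂, E₃]
  have hV : ∀ i, IsUpperSet (V i) := by
    intro i; fin_cases i
    · exact h₁
    · exact h₂
    · exact h₃
  have hcap : ∀ i j, i ≠ j → V i ∩ V j ⊆ {ω | ∃ k, (Am k : Set ι) ⊆ ω} := by
    intro i j hij
    rw [← hA]
    fin_cases i <;> fin_cases j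
    all_goals first
      | exact (hij rfl).elim
      | (change E₁ ∩ E₂ ⊆ A; exact h12.le)
      | (change E₂ ∩ E₁ ⊆ A; rw [Set.inter_comm]; exact h12.le)
      | (change E₁ ∩ E₃ ⊆ A; exact h13.le)
      | (change E₃ ∩ E₁ ⊆ A; rw [Set.inter_comm]; exact h13.le)
      | (change E₂ ∩ E₃ ⊆ A; exact h23.le)
      | (change E₃ ∩ E₂ ⊆ A; rw [Set.inter_comm]; exact h23.le)
  have key := prod_real_le_real_deltaCore_pow p Am h hsub hΔ hV hcap
  rw [Fin.prod_univ_three, ← hA] at key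
  simp only [V, Matrix.cons_val_zero, Matrix.cons_val_one, Matrix.cons_val, Fintype.card_fin] at key
  calc (prodBernoulli p).real E₁ * (prodBernoulli p).real E₂ * (prodBernoulli p).real E₃
      ≤ ((prodBernoulli p).real A) ^ (3 - 1) := key
    _ = ((prodBernoulli p).real A) ^ 2 := by norm_num

/-- **Lemma A in cells** (`c₁c₂c₃ ≤ a(ab − e₂)`) for Δ-system cores. [this work] -/
theorem e3_le_core_mul_AG_of_deltaCore (hsub : ∀ k, h ⊆ Am k) (hΔ : ∀ k l, k ≠ l → Am k ∩ Am l ⊆ h) {E₁ E₂ E₃ A : Set (Set ι)}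
    (h₁ : IsUpperSet E₁) (h₂ : IsUpperSet E₂) (h₃ : IsUpperSet E₃) (h12 : E₁ ∩ E₂ = A) (h13 : E₁ ∩ E₃ = A) (h23 : E₂ ∩ E₃ = A)
    (hA : A = {ω | ∃ k, (Am k : Set ι) ⊆ ω}) :
    (prodBernoulli p).real (E₁ \ A) * (prodBernoulli p).real (E₂ \ A) * (prodBernoulli p).real (E₃ \ A) ≤
      (prodBernoulli p).real A * ((prodBernoulli p).real A * (prodBernoulli p).real (E₁ ∪ E₂ ∪ E₃)ᶜ -
        ((prodBernoulli p).real (E₁ \ A) * (prodBernoulli p).real (E₂ \ A) +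
          (prodBernoulli p).real (E₁ \ A) * (prodBernoulli p).real (E₃ \ A) +
          (prodBernoulli p).real (E₂ \ A) * (prodBernoulli p).real (E₃ \ A))) := by
  have key := lemmaA_of_deltaCore p Am h hsub hΔ h₁ h₂ h₃ h12 h13 h23 hA
  obtain ⟨e₁, e₂, e₃, eB⟩ := PrincipalCore.cells_eq p h12 h13 h23
  rw [e₁, e₂, e₃] at key
  rw [eB]
  nlinarith [key]

/-- **(C1-law) for Δ-system cores**: `e₃ ≤ max(a,b)·(ab − e₂)`, unconditionally. [this work] -/
theorem e3_le_max_mul_AG_of_deltaCore (hsub : ∀ k, h ⊆ Am k) (hΔ : ∀ k l, k ≠ l → Am k ∩ Am l ⊆ h) {E₁ E₂ E₃ A : Set (Set ι)}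
    (h₁ : IsUpperSet E₁) (h₂ : IsUpperSet E₂) (h₃ : IsUpperSet E₃) (h12 : E₁ ∩ E₂ = A) (h13 : E₁ ∩ E₃ = A) (h23 : E₂ ∩ E₃ = A)
    (hA : A = {ω | ∃ k, (Am k : Set ι) ⊆ ω}) :
    (prodBernoulli p).real (E₁ \ A) * (prodBernoulli p).real (E₂ \ A) * (prodBernoulli p).real (E₃ \ A) ≤
      max ((prodBernoulli p).real A) ((prodBernoulli p).real (E₁ ∪ E₂ ∪ E₃)ᶜ) *
        ((prodBernoulli p).real A * (prodBernoulli p).real (E₁ ∪ E₂ ∪ E₃)ᶜ -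
          ((prodBernoulli p).real (E₁ \ A) * (prodBernoulli p).real (E₂ \ A) +
            (prodBernoulli p).real (E₁ \ A) * (prodBernoulli p).real (E₃ \ A) +
            (prodBernoulli p).real (E₂ \ A) * (prodBernoulli p).real (E₃ \ A))) := by
  have hLA := e3_le_core_mul_AG_of_deltaCore p Am h hsub hΔ h₁ h₂ h₃ h12 h13 h23 hA
  have hAG := prodBernoulli_strongHarris_sunflower_three p h₁ h₂ h₃ h12 h13 h23
  have hmax : (prodBernoulli p).real A ≤ max ((prodBernoulli p).real A) ((prodBernoulli p).real (E₁ ∪ E₂ ∪ E₃)ᶜ) :=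
    le_max_left _ _
  nlinarith [hmax, hAG, hLA]

/-- **The `H`-row** `(a+b)(ab − e₂) ≥ e₃` for Δ-system cores, unconditionally. [this work] -/
theorem lawH_nonneg_of_deltaCore (hsub : ∀ k, h ⊆ Am k) (hΔ : ∀ k l, k ≠ l → Am k ∩ Am l ⊆ h) {E₁ E₂ E₃ A : Set (Set ι)}
    (h₁ : IsUpperSet E₁) (h₂ : IsUpperSet E₂) (h₃ : IsUpperSet E₃) (h12 : E₁ ∩ E₂ = A) (h13 : E₁ ∩ E₃ = A) (h23 : E₂ ∩ E₃ = A)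
    (hA : A = {ω | ∃ k, (Am k : Set ι) ⊆ ω}) :
    0 ≤ ((prodBernoulli p).real A + (prodBernoulli p).real (E₁ ∪ E₂ ∪ E₃)ᶜ) *
        ((prodBernoulli p).real A * (prodBernoulli p).real (E₁ ∪ E₂ ∪ E₃)ᶜ -
          ((prodBernoulli p).real (E₁ \ A) * (prodBernoulli p).real (E₂ \ A) +
            (prodBernoulli p).real (E₁ \ A) * (prodBernoulli p).real (E₃ \ A) +
            (prodBernoulli p).real (E₂ \ A) * (prodBernoulli p).real (E₃ \ A))) -
      (prodBernoulli p).real (E₁ \ A) * (prodBernoulli p).real (E₂ \ A) * (prodBernoulli p).real (E₃ \ A) := by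
  have hLA := e3_le_core_mul_AG_of_deltaCore p Am h hsub hΔ h₁ h₂ h₃ h12 h13 h23 hA
  have hAG := prodBernoulli_strongHarris_sunflower_three p h₁ h₂ h₃ h12 h13 h23
  have hb : 0 ≤ (prodBernoulli p).real (E₁ ∪ E₂ ∪ E₃)ᶜ := measureReal_nonneg
  nlinarith [hb, hAG, hLA]

/-- **Kahn's Conjecture 5 / Sahi `E₃ ≥ 0` for the complements of a sunflower of up-sets with a Δ-system core**, unconditionally. [this work] -/
theorem sahiE3_compl_nonneg_of_deltaCore (hsub : ∀ k, h ⊆ Am k) (hΔ : ∀ k l, k ≠ l → Am k ∩ Am l ⊆ h) {E₁ E₂ E₃ A : Set (Set ι)}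
    (h₁ : IsUpperSet E₁) (h₂ : IsUpperSet E₂) (h₃ : IsUpperSet E₃) (h12 : E₁ ∩ E₂ = A) (h13 : E₁ ∩ E₃ = A) (h23 : E₂ ∩ E₃ = A)
    (hA : A = {ω | ∃ k, (Am k : Set ι) ⊆ ω}) :
    0 ≤ sahiE3 (prodBernoulli p) E₁ᶜ E₂ᶜ E₃ᶜ := by
  classical
  have m₁ : MeasurableSet E₁ := MeasurableSet.of_discrete
  have m₂ : MeasurableSet E₂ := MeasurableSet.of_discrete
  have m₃ : MeasurableSet E₃ := MeasurableSet.of_discrete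
  rw [sahiE3_compl_sunflower_eq (prodBernoulli p) m₁ m₂ m₃ h12 h13 h23]
  have hLA := e3_le_core_mul_AG_of_deltaCore p Am h hsub hΔ h₁ h₂ h₃ h12 h13 h23 hA
  have hAG := prodBernoulli_strongHarris_sunflower_three p h₁ h₂ h₃ h12 h13 h23
  have ha0 : 0 ≤ (prodBernoulli p).real A := measureReal_nonneg
  nlinarith [ha0, hAG, hLA]

end Corollaries

end DeltaCore

end Summit.CriticalPhenomena.PercolationContinuityZ3.Theorems.SunflowerPartition
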